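import Summits.AtomisticToContinuum.FouriersLaw.Theorems.EmbeddedDrudeMourreDrudeDissolutionStubPencilDerivationGenerator
import Summits.AtomisticToContinuum.FouriersLaw.Theorems.EmbeddedDrudeMourreDrudeDissolutionStubPencilDerivationFoelner
import HarnessLib

/-!
# Stub C `stub_pencilDerivation`, part (ii-a): the Koopman generator on polynomial classes,
unconditionally (line `gram-pencil-harmonic-chaos`, crux `EmbeddedDrudeMourre.DrudeDissolution`,
item stmt-AtomisticToContinuum-12593; `--supports` file, closes nothing)

WHAT. For every zero-wavenumber datum `Z` of `pinnedChain ω₂ lam β γ` as delivered by stub F (dynamics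
the identity off `bmGood = D.carrier`, strongly continuous Koopman group, observables = flow-orbit of the
local polynomials `𝒫`) and every `u ∈ 𝒫`, `t ↦ U_t [u]` has derivative `[liouvilleZ P u]` at `0` in
`ℋ₀(Z.μ)` (registered sub-goal `stub_pencilDerivation_domain`) — NO uniform-in-time clustering needed.

IDEA. With `b = 𝓛u`, `a_t = t⁻¹(u∘φ_t - u) - b = t⁻¹∫₀ᵗ (b∘φ_s - b) ds` pointwise a.e. The class map
is unbounded from `L²(μ)` to `ℋ₀`, but `‖[c]‖₀² = lim_n n⁻¹ Var(S_n c)`, `S_n c = Σ_{i<n} c∘τ_i`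
(Følner representation, `stub_pencilDerivation_foelner`), and at FINITE `n` the time average commutes
with `S_n`: `S_n a_t = t⁻¹ ∫₀ᵗ S_n(b∘φ_s - b) ds`, whence by Fubini and AM–GM in `L²(μ)`
`E[(S_n a_t)²] ≤ |t|⁻¹ ∫_{Ι 0 t} E[(S_n(b∘φ_s - b))²] ds`, while STATIONARITY bounds the integrand
uniformly: `E[(S_n(b∘φ_s - b))²] ≤ 2 Var(S_n(b∘φ_s)) + 2 Var(S_n b) = 4 Var(S_n b) ≤ 4n Σ_x |Cov(b, b∘τ_x)|`.
Dominated convergence in `s` as `n → ∞` gives `‖[a_t]‖₀² ≤ t⁻¹ ∫₀ᵗ ‖U_s[b] - [b]‖₀² ds → 0` (strong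
continuity), i.e. `t⁻¹(U_t[u] - [u]) → [b]`.
-/

noncomputable section

open MeasureTheory ProbabilityTheory Filter Set Function Topology
open scoped InnerProductSpace ENNReal ProbabilityTheory
open Literature.MathematicalPhysics.KineticTheory
open Literature.MathematicalPhysics.KineticTheory.HeatConduction
open Literature.MathematicalPhysics.KineticTheory.PhononBoltzmann

namespace Summit.AtomisticToContinuum.FouriersLaw.Theorems.DrudeDissolution.GramPencilHarmonicChaos

/-- Integrals are invariant under a measure-preserving self-map. [folklore] -/
theorem integral_comp_eq_of_measurePreserving {μ : Measure ChainConfig} {f : ChainConfig → ChainConfig}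
    (hf : MeasurePreserving f μ μ) {g : ChainConfig → ℝ} (hg : AEStronglyMeasurable g μ) :
    ∫ σ, g (f σ) ∂μ = ∫ σ, g σ ∂μ := by
  have h := integral_map (μ := μ) hf.measurable.aemeasurable (f := g) (by rw [hf.map_eq]; exact hg)
  rw [hf.map_eq] at h
  exact h.symm

section Datum

variable {ω₂ lam β γ : ℝ} {D : InfiniteChainDynamics (pinnedChain ω₂ lam β γ)}
  (Z : ZeroWavenumberData (pinnedChain ω₂ lam β γ) D)

/-- Birkhoff sums of observables are observables. [folklore] -/
theorem birkhoffSum_mem {c : ChainConfig → ℝ} (hc : c ∈ Z.localObs) (n : ℕ) :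
    (∑ i ∈ Finset.range n, c ∘ chainShift (i : ℤ)) ∈ Z.localObs :=
  Submodule.sum_mem _ fun i _ => Z.comp_shift_mem (i : ℤ) hc

/-- **Stationarity bound for the time-displaced Birkhoff sums**: for an observable `b` and every `s`,
`E[(S_n(b∘φ_s - b))²] ≤ 4 Var(S_n b)` (equal means, `Var(S_n(b∘φ_s)) = Var(S_n b)` since
`S_n(b∘φ_s) = (S_n b)∘φ_s` a.e.), and `E[(S_n(b∘φ_s - b))²] = Var(S_n(b∘φ_s - b))`. [folklore] -/
theorem integral_sq_birkhoffSum_flow_sub_le {b : ChainConfig → ℝ} (hb : b ∈ Z.localObs) (s : ℝ) (n : ℕ) :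
    ∫ σ, ((∑ i ∈ Finset.range n, (b ∘ D.flow s - b) ∘ chainShift (i : ℤ)) σ) ^ 2 ∂Z.μ ≤
        4 * Var[∑ i ∈ Finset.range n, b ∘ chainShift (i : ℤ); Z.μ] ∧
      Var[∑ i ∈ Finset.range n, (b ∘ D.flow s - b) ∘ chainShift (i : ℤ); Z.μ] =
        ∫ σ, ((∑ i ∈ Finset.range n, (b ∘ D.flow s - b) ∘ chainShift (i : ℤ)) σ) ^ 2 ∂Z.μ := by
  have hbs : b ∘ D.flow s ∈ Z.localObs := Z.comp_flow_mem s hb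
  have h1 : (∑ i ∈ Finset.range n, (b ∘ D.flow s - b) ∘ chainShift (i : ℤ)) =
      (∑ i ∈ Finset.range n, (b ∘ D.flow s) ∘ chainShift (i : ℤ)) -
        ∑ i ∈ Finset.range n, b ∘ chainShift (i : ℤ) := by
    rw [← Finset.sum_sub_distrib]
    rfl
  have hX : MemLp (∑ i ∈ Finset.range n, (b ∘ D.flow s) ∘ chainShift (i : ℤ)) 2 Z.μ :=
    Z.memLp_of_mem (birkhoffSum_mem Z hbs n)
  have hY : MemLp (∑ i ∈ Finset.range n, b ∘ chainShift (i : ℤ)) 2 Z.μ :=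
    Z.memLp_of_mem (birkhoffSum_mem Z hb n)
  -- `S_n(b∘φ_s) = (S_n b)∘φ_s` a.e.
  have hae : (∑ i ∈ Finset.range n, (b ∘ D.flow s) ∘ chainShift (i : ℤ)) =ᵐ[Z.μ]
      (∑ i ∈ Finset.range n, b ∘ chainShift (i : ℤ)) ∘ D.flow s := by
    have h : ∀ i ∈ Finset.range n, ((b ∘ D.flow s) ∘ chainShift (i : ℤ)) =ᵐ[Z.μ]
        (b ∘ chainShift (i : ℤ)) ∘ D.flow s :=
      fun i _ => (Z.flow_comm_shift s (i : ℤ)).fun_comp b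
    have h' := (ae_ball_iff (Finset.countable_toSet _)).2 h
    filter_upwards [h'] with σ hσ
    simp only [Finset.sum_apply, comp_apply]
    exact Finset.sum_congr rfl fun i hi => by simpa using hσ i hi
  have hmean : Z.μ[∑ i ∈ Finset.range n, (b ∘ D.flow s) ∘ chainShift (i : ℤ)] =
      Z.μ[∑ i ∈ Finset.range n, b ∘ chainShift (i : ℤ)] := by
    rw [integral_congr_ae hae]
    exact integral_comp_eq_of_measurePreserving (Z.measurePreserving_flow s) hY.1
  have hvar : Var[∑ i ∈ Finset.range n, (b ∘ D.flow s) ∘ chainShift (i : ℤ); Z.μ] =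
      Var[∑ i ∈ Finset.range n, b ∘ chainShift (i : ℤ); Z.μ] := by
    have hYm : AEMeasurable (∑ i ∈ Finset.range n, b ∘ chainShift (i : ℤ)) Z.μ :=
      hY.aestronglyMeasurable.aemeasurable
    have hYm' : AEMeasurable ((∑ i ∈ Finset.range n, b ∘ chainShift (i : ℤ)) ∘ D.flow s) Z.μ := by
      have h := hYm
      rw [← (Z.measurePreserving_flow s).map_eq] at h
      exact h.comp_measurable (Z.measurePreserving_flow s).measurable
    rw [← covariance_self hX.aestronglyMeasurable.aemeasurable, covariance_congr_ae hae hae,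
      covariance_self hYm']
    exact (Z.measurePreserving_flow s).variance_fun_comp hYm
  refine ⟨?_, ?_⟩
  · rw [h1]
    have h := integral_sub_sq_le_two_mul_variance_add hX hY hmean
    rw [hvar] at h
    refine le_trans (le_of_eq ?_) (h.trans_eq (by ring))
    rfl
  · rw [variance_eq_sub (Z.memLp_of_mem (birkhoffSum_mem Z (Z.localObs.sub_mem hbs hb) n))]
    have h0 : Z.μ[∑ i ∈ Finset.range n, (b ∘ D.flow s - b) ∘ chainShift (i : ℤ)] = 0 := by
      rw [h1, integral_sub' (hX.integrable one_le_two) (hY.integrable one_le_two), hmean, sub_self]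
    rw [h0]
    simp

/-- Joint measurability of the time-displaced Birkhoff sums `(s, σ) ↦ S_n(b∘φ_s - b)(σ)` for a local
polynomial `b` (continuous orbits under the normal form). [folklore] -/
theorem measurable_birkhoffSum_flow_sub (hcar : D.carrier = (pinnedChain ω₂ lam β γ).bmGood)
    (hoff : ∀ (t : ℝ) (σ : ChainConfig), σ ∉ (pinnedChain ω₂ lam β γ).bmGood → D.flow t σ = σ)
    (hfl : ∀ s : ℝ, Measurable (D.flow s)) {b : ChainConfig → ℝ} (hbP : b ∈ (Algebra.adjoin ℝ (Set.range fun xc : ℤ × Bool => fun σ : ChainConfig =>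
      if xc.2 then (σ xc.1).2 else (σ xc.1).1))) (n : ℕ) :
    Measurable fun p : ℝ × ChainConfig =>
      (∑ i ∈ Finset.range n, (b ∘ D.flow p.1 - b) ∘ chainShift (i : ℤ)) p.2 := by
  have hbc : Continuous b := continuous_of_mem_localPolynomials hbP
  have hbm : Measurable b := hbc.measurable
  have h : (fun p : ℝ × ChainConfig => (∑ i ∈ Finset.range n, (b ∘ D.flow p.1 - b) ∘ chainShift (i : ℤ)) p.2) =
      fun p => ∑ i ∈ Finset.range n, (b (D.flow p.1 (chainShift (i : ℤ) p.2)) - b (chainShift (i : ℤ) p.2)) := by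
    funext p
    simp only [Finset.sum_apply, comp_apply, Pi.sub_apply]
  rw [h]
  refine Finset.measurable_sum _ fun i _ => Measurable.sub ?_ (hbm.comp ((chainShift.measurable _).comp measurable_snd))
  exact measurable_uncurry_of_continuous_of_measurable (u := fun (s : ℝ) (σ : ChainConfig) => b (D.flow s (chainShift (i : ℤ) σ)))
    (fun σ => hbc.comp (continuous_flow_apply hcar hoff _))
    (fun s => hbm.comp ((hfl s).comp (chainShift.measurable _)))

/-- **The finite-volume time average (Fubini + AM–GM in `L²(μ)`)**: for `u ∈ 𝒫`, `b = 𝓛u`,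
`a_t = t⁻¹(u∘φ_t - u) - b` and every `n`,
`E[(S_n a_t)²] ≤ |t|⁻¹ ∫_{Ι 0 t} E[(S_n(b∘φ_s - b))²] ds` (pointwise a.e. `S_n a_t = t⁻¹∫₀ᵗ S_n(b∘φ_s - b) ds`).
[folklore] -/
theorem integral_sq_birkhoffSum_slope_le (hcar : D.carrier = (pinnedChain ω₂ lam β γ).bmGood)
    (hoff : ∀ (t : ℝ) (σ : ChainConfig), σ ∉ (pinnedChain ω₂ lam β γ).bmGood → D.flow t σ = σ)
    (hloc : Z.localObs = Submodule.span ℝ {w : ChainConfig → ℝ | ∃ u ∈ (Algebra.adjoin ℝ (Set.range fun xc : ℤ × Bool => fun σ : ChainConfig =>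
      if xc.2 then (σ xc.1).2 else (σ xc.1).1)), ∃ s : ℝ, w = u ∘ D.flow s})
    {u : ChainConfig → ℝ} (hu : u ∈ (Algebra.adjoin ℝ (Set.range fun xc : ℤ × Bool => fun σ : ChainConfig =>
      if xc.2 then (σ xc.1).2 else (σ xc.1).1))) {t : ℝ} (ht : t ≠ 0) (n : ℕ) :
    ∫ σ, ((∑ i ∈ Finset.range n, (t⁻¹ • (u ∘ D.flow t - u) - liouvilleZ (pinnedChain ω₂ lam β γ) u) ∘
        chainShift (i : ℤ)) σ) ^ 2 ∂Z.μ ≤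
      |t|⁻¹ * ∫ s in Set.uIoc 0 t, ∫ σ, ((∑ i ∈ Finset.range n,
        (liouvilleZ (pinnedChain ω₂ lam β γ) u ∘ D.flow s - liouvilleZ (pinnedChain ω₂ lam β γ) u) ∘
          chainShift (i : ℤ)) σ) ^ 2 ∂Z.μ := by
  set b := liouvilleZ (pinnedChain ω₂ lam β γ) u with hb
  set a := t⁻¹ • (u ∘ D.flow t - u) - b with ha
  set X := ∑ i ∈ Finset.range n, a ∘ chainShift (i : ℤ) with hX
  set G : ℝ → ChainConfig → ℝ := fun s => ∑ i ∈ Finset.range n, (b ∘ D.flow s - b) ∘ chainShift (i : ℤ)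
    with hG
  have hbP : b ∈ (Algebra.adjoin ℝ (Set.range fun xc : ℤ × Bool => fun σ : ChainConfig =>
      if xc.2 then (σ xc.1).2 else (σ xc.1).1)) := stub_pencilDerivation_algebra ω₂ lam β γ u hu
  have hbl : b ∈ Z.localObs := mem_localObs_of_mem_localPolynomials Z hcar hoff hloc hbP
  have hul : u ∈ Z.localObs := mem_localObs_of_mem_localPolynomials Z hcar hoff hloc hu
  have hbc : Continuous b := continuous_of_mem_localPolynomials hbP
  have hb2 : MemLp b 2 Z.μ := Z.memLp_of_mem hbl
  have hal : a ∈ Z.localObs :=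
    Z.localObs.sub_mem (Z.localObs.smul_mem _ (Z.localObs.sub_mem (Z.comp_flow_mem t hul) hul)) hbl
  have hXl : X ∈ Z.localObs := birkhoffSum_mem Z hal n
  have hX2 : MemLp X 2 Z.μ := Z.memLp_of_mem hXl
  have hum : Measurable u := (continuous_of_mem_localPolynomials hu).measurable
  have ham : Measurable a :=
    (((hum.comp (Z.measurePreserving_flow t).measurable).sub hum).const_smul _).sub hbc.measurable
  have hXm : Measurable X := by
    rw [hX, Finset.sum_fn]
    exact Finset.measurable_sum _ fun i _ => ham.comp (chainShift.measurable _)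
  -- the measure-preserving families along which `X` is paired
  have hΦm : ∀ (i : ℕ) (s : ℝ), MeasurePreserving (fun σ => D.flow s (chainShift (i : ℤ) σ)) Z.μ Z.μ :=
    fun i s => (Z.measurePreserving_flow s).comp (Z.measurePreserving_shift (i : ℤ))
  have hΦc : ∀ (i : ℕ) (σ : ChainConfig), Continuous fun s : ℝ => D.flow s (chainShift (i : ℤ) σ) :=
    fun i σ => continuous_flow_apply hcar hoff _
  have hF := fun i : ℕ => integral_intervalIntegral_mul_comp_orbit (hΦm i) (hΦc i) hXm hX2 hbc hb2 0 t
  -- per site: `E[X · a∘τ_i] = t⁻¹ ∫₀ᵗ (E[X · b∘φ_s∘τ_i] - E[X · b∘τ_i]) ds`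
  have hae : ∀ᵐ σ ∂Z.μ, ∀ i ∈ Finset.range n, chainShift (i : ℤ) σ ∈ D.carrier :=
    (ae_ball_iff (Finset.countable_toSet _)).2 fun i _ =>
      (Z.measurePreserving_shift (i : ℤ)).quasiMeasurePreserving.ae Z.ae_mem_carrier
  have hconst : ∀ i : ℕ, Integrable (fun σ => X σ * b (chainShift (i : ℤ) σ)) Z.μ := fun i =>
    hX2.integrable_mul (hb2.comp_measurePreserving (Z.measurePreserving_shift (i : ℤ)))
  have hsite : ∀ i ∈ Finset.range n, ∫ σ, X σ * a (chainShift (i : ℤ) σ) ∂Z.μ =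
      t⁻¹ * ∫ s in (0 : ℝ)..t, (∫ σ, X σ * b (D.flow s (chainShift (i : ℤ) σ)) ∂Z.μ -
        ∫ σ, X σ * b (chainShift (i : ℤ) σ) ∂Z.μ) := by
    intro i hi
    have hI := integrable_prod_mul_comp_orbit (hΦm i) (hΦc i) hXm hX2 hbc hb2 0 t
    have hJ : Integrable (fun σ => ∫ s in (0 : ℝ)..t, X σ * b (D.flow s (chainShift (i : ℤ) σ))) Z.μ := by
      simp only [intervalIntegral.intervalIntegral_eq_integral_uIoc]
      exact hI.integral_prod_left.smul (if (0 : ℝ) ≤ t then (1 : ℝ) else -1)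
    have lhs : ∫ σ, X σ * a (chainShift (i : ℤ) σ) ∂Z.μ =
        t⁻¹ * ∫ σ, (∫ s in (0 : ℝ)..t, X σ * b (D.flow s (chainShift (i : ℤ) σ))) ∂Z.μ -
          ∫ σ, X σ * b (chainShift (i : ℤ) σ) ∂Z.μ := by
      rw [← integral_const_mul, ← integral_sub (hJ.const_mul _) (hconst i)]
      refine integral_congr_ae ?_
      filter_upwards [hae] with σ hσ
      have hFTC := localPolynomial_comp_flow_sub_eq_integral D hu (hσ i hi) t
      rw [intervalIntegral.integral_const_mul]
      simp only [ha, Pi.sub_apply, Pi.smul_apply, comp_apply, smul_eq_mul]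
      rw [hFTC]
      simp only [hb]
      ring
    rw [lhs, (hF i).1, intervalIntegral.integral_sub (hF i).2 intervalIntegrable_const,
      intervalIntegral.integral_const, sub_zero, smul_eq_mul, mul_sub, ← mul_assoc, inv_mul_cancel₀ ht, one_mul]
  -- sum over sites: `E[X²] = t⁻¹ ∫₀ᵗ E[X · G_s] ds`
  have hXG : ∀ s : ℝ, ∫ σ, X σ * G s σ ∂Z.μ = ∑ i ∈ Finset.range n,
      (∫ σ, X σ * b (D.flow s (chainShift (i : ℤ) σ)) ∂Z.μ - ∫ σ, X σ * b (chainShift (i : ℤ) σ) ∂Z.μ) := by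
    intro s
    have hint : ∀ i : ℕ, Integrable (fun σ => X σ * b (D.flow s (chainShift (i : ℤ) σ))) Z.μ := fun i =>
      hX2.integrable_mul (hb2.comp_measurePreserving (hΦm i s))
    rw [Finset.sum_congr rfl fun i _ => (integral_sub (hint i) (hconst i)).symm,
      ← integral_finsetSum (Finset.range n) fun (i : ℕ) _ => (show Integrable (fun σ => X σ *
        b (D.flow s (chainShift (i : ℤ) σ)) - X σ * b (chainShift (i : ℤ) σ)) Z.μ from (hint i).sub (hconst i))]
    refine integral_congr_ae (Eventually.of_forall fun σ => ?_)
    simp only [hG, Finset.sum_apply, comp_apply, Pi.sub_apply, Finset.mul_sum, mul_sub]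
  have key1 : ∫ σ, (X σ) ^ 2 ∂Z.μ = t⁻¹ * ∫ s in (0 : ℝ)..t, ∫ σ, X σ * G s σ ∂Z.μ := by
    have e1 : (fun σ => (X σ) ^ 2) = fun σ => ∑ i ∈ Finset.range n, X σ * a (chainShift (i : ℤ) σ) := by
      funext σ
      rw [sq, hX, Finset.sum_apply, Finset.mul_sum]
      rfl
    have hint : ∀ i : ℕ, Integrable (fun σ => X σ * a (chainShift (i : ℤ) σ)) Z.μ := fun i =>
      hX2.integrable_mul ((Z.memLp_of_mem hal).comp_measurePreserving (Z.measurePreserving_shift (i : ℤ)))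
    rw [e1, integral_finsetSum _ fun i _ => hint i, Finset.sum_congr rfl hsite, ← Finset.mul_sum,
      ← intervalIntegral.integral_finsetSum]
    · congr 1
      exact intervalIntegral.integral_congr fun s _ => (hXG s).symm
    · intro i _
      exact (hF i).2.sub intervalIntegrable_const
  -- AM–GM in `L²(μ)` and absorption
  have hGl : ∀ s : ℝ, G s ∈ Z.localObs := fun s =>
    birkhoffSum_mem Z (Z.localObs.sub_mem (Z.comp_flow_mem s hbl) hbl) n
  have hamgm : ∀ s : ℝ, ∫ σ, X σ * G s σ ∂Z.μ ≤ (∫ σ, (X σ) ^ 2 ∂Z.μ + ∫ σ, (G s σ) ^ 2 ∂Z.μ) / 2 := by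
    intro s
    have hG2 : MemLp (G s) 2 Z.μ := Z.memLp_of_mem (hGl s)
    rw [← integral_add hX2.integrable_sq hG2.integrable_sq, ← integral_div]
    refine integral_mono (hX2.integrable_mul hG2) ((hX2.integrable_sq.add hG2.integrable_sq).div_const 2)
      fun σ => ?_
    dsimp only
    nlinarith [sq_nonneg (X σ - G s σ)]
  -- integrability in `s` of `E[G_s²]` (measurable, bounded by `4 Var(S_n b)`)
  have hfin : volume (Set.uIoc 0 t) < ∞ := by rw [Real.volume_uIoc]; exact ENNReal.ofReal_lt_top
  haveI : IsFiniteMeasure (volume.restrict (Set.uIoc 0 t)) :=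
    ⟨by rw [Measure.restrict_apply_univ]; exact hfin⟩
  have hGi : Integrable (fun s => ∫ σ, (G s σ) ^ 2 ∂Z.μ) (volume.restrict (Set.uIoc 0 t)) := by
    refine Integrable.mono' (integrable_const (4 * Var[∑ i ∈ Finset.range n, b ∘ chainShift (i : ℤ); Z.μ]))
      ?_ (Eventually.of_forall fun s => ?_)
    · have hm := measurable_birkhoffSum_flow_sub hcar hoff (fun s => (Z.measurePreserving_flow s).measurable) hbP n
      exact ((hm.pow_const 2).stronglyMeasurable.integral_prod_right (ν := Z.μ)).aestronglyMeasurable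
    · rw [Real.norm_eq_abs, abs_of_nonneg (integral_nonneg fun σ => sq_nonneg _)]
      exact (integral_sq_birkhoffSum_flow_sub_le Z hbl s n).1
  have hXGi : Integrable (fun s => ∫ σ, X σ * G s σ ∂Z.μ) (volume.restrict (Set.uIoc 0 t)) := by
    have h : IntervalIntegrable (fun s => ∫ σ, X σ * G s σ ∂Z.μ) volume 0 t := by
      have h' := IntervalIntegrable.sum (μ := volume) (a := 0) (b := t) (Finset.range n) fun i _ =>
        (hF i).2.sub (intervalIntegrable_const (c := ∫ σ, X σ * b (chainShift (i : ℤ) σ) ∂Z.μ))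
      rw [Finset.sum_fn] at h'
      exact h'.congr fun s _ => (hXG s).symm
    exact (intervalIntegrable_iff.1 h)
  have hvol : (volume.restrict (Set.uIoc (0 : ℝ) t)).real Set.univ = |t| := by
    rw [measureReal_restrict_apply_univ, measureReal_def, Real.volume_uIoc, sub_zero,
      ENNReal.toReal_ofReal (abs_nonneg t)]
  have key2 : ∫ σ, (X σ) ^ 2 ∂Z.μ ≤ (∫ σ, (X σ) ^ 2 ∂Z.μ) / 2 +
      |t|⁻¹ * (∫ s in Set.uIoc 0 t, ∫ σ, (G s σ) ^ 2 ∂Z.μ) / 2 := by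
    have hL : ∫ σ, (X σ) ^ 2 ∂Z.μ = |t|⁻¹ * ∫ s in Set.uIoc 0 t, ∫ σ, X σ * G s σ ∂Z.μ := by
      rw [key1, inv_mul_intervalIntegral_eq]
    have hrhs : Integrable (fun s => (∫ σ, (X σ) ^ 2 ∂Z.μ + ∫ σ, (G s σ) ^ 2 ∂Z.μ) / 2)
        (volume.restrict (Set.uIoc 0 t)) := ((integrable_const _).add hGi).div_const 2
    have hmono := integral_mono hXGi hrhs fun s => hamgm s
    have e : ∫ s in Set.uIoc 0 t, (∫ σ, (X σ) ^ 2 ∂Z.μ + ∫ σ, (G s σ) ^ 2 ∂Z.μ) / 2 =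
        |t| * (∫ σ, (X σ) ^ 2 ∂Z.μ) / 2 + (∫ s in Set.uIoc 0 t, ∫ σ, (G s σ) ^ 2 ∂Z.μ) / 2 := by
      rw [integral_div, integral_add (integrable_const _) hGi, integral_const, hvol, smul_eq_mul, add_div]
    rw [e] at hmono
    have htpos : 0 < |t| := abs_pos.2 ht
    calc ∫ σ, (X σ) ^ 2 ∂Z.μ = |t|⁻¹ * ∫ s in Set.uIoc 0 t, ∫ σ, X σ * G s σ ∂Z.μ := hL
      _ ≤ |t|⁻¹ * (|t| * (∫ σ, (X σ) ^ 2 ∂Z.μ) / 2 + (∫ s in Set.uIoc 0 t, ∫ σ, (G s σ) ^ 2 ∂Z.μ) / 2) :=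
          mul_le_mul_of_nonneg_left hmono (inv_nonneg.2 htpos.le)
      _ = (∫ σ, (X σ) ^ 2 ∂Z.μ) / 2 + |t|⁻¹ * (∫ s in Set.uIoc 0 t, ∫ σ, (G s σ) ^ 2 ∂Z.μ) / 2 := by
          field_simp
  linarith [key2]

end Datum

/-- **Stub C, conjunct (ii-a), unconditionally** (registered sub-goal `stub_pencilDerivation_domain`): for
a datum as delivered by stub F, `t ↦ U_t [u]` has derivative `[liouvilleZ P u]` at `0` in `ℋ₀(Z.μ)` for
every local polynomial `u` — Doyon's generator IS the class map of `liouvilleZ` on polynomial classes.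
[cite: Doyon2022, §4.2 eqs. (4.9)–(4.10), Thm 4.11] -/
theorem stub_pencilDerivation_domain : ∀ ω₂ lam β γ : ℝ, ∀ (D : Literature.MathematicalPhysics.KineticTheory.HeatConduction.InfiniteChainDynamics (Literature.MathematicalPhysics.KineticTheory.HeatConduction.pinnedChain ω₂ lam β γ)) (Z : Literature.MathematicalPhysics.KineticTheory.HeatConduction.ZeroWavenumberData (Literature.MathematicalPhysics.KineticTheory.HeatConduction.pinnedChain ω₂ lam β γ) D), D.carrier = (Literature.MathematicalPhysics.KineticTheory.HeatConduction.pinnedChain ω₂ lam β γ).bmGood → (∀ (t : ℝ) (σ : Literature.MathematicalPhysics.KineticTheory.HeatConduction.ChainConfig), σ ∉ (Literature.MathematicalPhysics.KineticTheory.HeatConduction.pinnedChain ω₂ lam β γ).bmGood → D.flow t σ = σ) → Z.toFluctuationDynamics.IsStronglyContinuous → Z.localObs = Submodule.span ℝ {w : Literature.MathematicalPhysics.KineticTheory.HeatConduction.ChainConfig → ℝ | ∃ u ∈ Algebra.adjoin ℝ (Set.range fun xc : ℤ × Bool => fun σ : Literature.MathematicalPhysics.KineticTheory.HeatConduction.ChainConfig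 => if xc.2 then (σ xc.1).2 else (σ xc.1).1), ∃ s : ℝ, w = u ∘ D.flow s} → ∀ u ∈ Algebra.adjoin ℝ (Set.range fun xc : ℤ × Bool => fun σ : Literature.MathematicalPhysics.KineticTheory.HeatConduction.ChainConfig => if xc.2 then (σ xc.1).2 else (σ xc.1).1), HasDerivAt (fun t : ℝ => (Z.koopman t (Z.fluct u) : Literature.MathematicalPhysics.KineticTheory.HeatConduction.ZeroWavenumberSpace Z)) (Z.fluct (Literature.MathematicalPhysics.KineticTheory.HeatConduction.liouvilleZ (Literature.MathematicalPhysics.KineticTheory.HeatConduction.pinnedChain ω₂ lam β γ) u)) 0 := by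
  intro ω₂ lam β γ D Z hcar hoff hU hloc u hu
  set b := liouvilleZ (pinnedChain ω₂ lam β γ) u with hb
  have hbP : b ∈ (Algebra.adjoin ℝ (Set.range fun xc : ℤ × Bool => fun σ : ChainConfig =>
      if xc.2 then (σ xc.1).2 else (σ xc.1).1)) := stub_pencilDerivation_algebra ω₂ lam β γ u hu
  have hbl : b ∈ Z.localObs := mem_localObs_of_mem_localPolynomials Z hcar hoff hloc hbP
  have hul : u ∈ Z.localObs := mem_localObs_of_mem_localPolynomials Z hcar hoff hloc hu
  have hzero : ∀ ψ : ZeroWavenumberSpace Z, Z.koopman 0 ψ = ψ :=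
    fun ψ => Z.toFluctuationDynamics.koopman_zero_apply ψ
  set K : ℝ := ∑' x : ℤ, |cov[b, b ∘ chainShift x; Z.μ]| with hK
  have hK0 : 0 ≤ K := tsum_nonneg fun x => abs_nonneg _
  have hcs : ∀ s : ℝ, b ∘ D.flow s - b ∈ Z.localObs := fun s => Z.localObs.sub_mem (Z.comp_flow_mem s hbl) hbl
  have hφc : Continuous fun s : ℝ => ‖Z.koopman s (Z.fluct b) - Z.fluct b‖ ^ 2 :=
    ((hU (Z.fluct b)).sub continuous_const).norm.pow 2
  have hφ : ∀ s : ℝ, Z.form (b ∘ D.flow s - b) (b ∘ D.flow s - b) = ‖Z.koopman s (Z.fluct b) - Z.fluct b‖ ^ 2 := by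
    intro s
    rw [← FluctuationStructure.norm_fluct_sq (hcs s), FluctuationStructure.fluct_sub (Z.comp_flow_mem s hbl) hbl,
      Z.koopman_fluct s hbl]
  -- the finite-volume functions `F n s = n⁻¹ E[(S_n(b∘φ_s - b))²]`
  set F : ℕ → ℝ → ℝ := fun n s => (n : ℝ)⁻¹ *
    ∫ σ, ((∑ i ∈ Finset.range n, (b ∘ D.flow s - b) ∘ chainShift (i : ℤ)) σ) ^ 2 ∂Z.μ with hF
  have hFm : ∀ n : ℕ, StronglyMeasurable (F n) := by
    intro n
    have hm := measurable_birkhoffSum_flow_sub hcar hoff (fun s => (Z.measurePreserving_flow s).measurable) hbP n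
    exact ((hm.pow_const 2).stronglyMeasurable.integral_prod_right (ν := Z.μ)).const_mul _
  have hFb : ∀ (n : ℕ) (s : ℝ), ‖F n s‖ ≤ 4 * K := by
    intro n s
    have hb4 := (integral_sq_birkhoffSum_flow_sub_le Z hbl s n).1
    have hvb := (stub_pencilDerivation_foelner _ D Z b hbl).2 n
    have hI0 : 0 ≤ ∫ σ, ((∑ i ∈ Finset.range n, (b ∘ D.flow s - b) ∘ chainShift (i : ℤ)) σ) ^ 2 ∂Z.μ :=
      integral_nonneg fun _ => sq_nonneg _
    rw [hF, Real.norm_eq_abs, abs_of_nonneg (mul_nonneg (inv_nonneg.2 (Nat.cast_nonneg n)) hI0)]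
    rcases Nat.eq_zero_or_pos n with hn | hn
    · subst hn
      simp only [Nat.cast_zero, inv_zero, zero_mul]
      positivity
    · have hn' : (0 : ℝ) < n := by exact_mod_cast hn
      calc (n : ℝ)⁻¹ * ∫ σ, ((∑ i ∈ Finset.range n, (b ∘ D.flow s - b) ∘ chainShift (i : ℤ)) σ) ^ 2 ∂Z.μ
          ≤ (n : ℝ)⁻¹ * (4 * (n * K)) := mul_le_mul_of_nonneg_left (hb4.trans (by linarith)) (inv_nonneg.2 hn'.le)
        _ = 4 * K := by field_simp
  have hFlim : ∀ s : ℝ, Tendsto (fun n : ℕ => F n s) atTop (𝓝 (‖Z.koopman s (Z.fluct b) - Z.fluct b‖ ^ 2)) := by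
    intro s
    have h := (stub_pencilDerivation_foelner _ D Z _ (hcs s)).1
    rw [hφ s] at h
    refine h.congr fun n => ?_
    rw [hF, (integral_sq_birkhoffSum_flow_sub_le Z hbl s n).2]
  -- main inequality for `t ≠ 0`
  have hmain : ∀ t : ℝ, t ≠ 0 → ‖t⁻¹ • (Z.koopman t (Z.fluct u) - Z.fluct u) - Z.fluct b‖ ^ 2 ≤
      t⁻¹ * ∫ s in (0 : ℝ)..t, ‖Z.koopman s (Z.fluct b) - Z.fluct b‖ ^ 2 := by
    intro t ht
    set a := t⁻¹ • (u ∘ D.flow t - u) - b with ha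
    have hut : u ∘ D.flow t - u ∈ Z.localObs := Z.localObs.sub_mem (Z.comp_flow_mem t hul) hul
    have hal : a ∈ Z.localObs := Z.localObs.sub_mem (Z.localObs.smul_mem _ hut) hbl
    have hfa : Z.fluct a = t⁻¹ • (Z.koopman t (Z.fluct u) - Z.fluct u) - Z.fluct b := by
      rw [ha, FluctuationStructure.fluct_sub (Z.localObs.smul_mem _ hut) hbl,
        FluctuationStructure.fluct_smul _ hut, FluctuationStructure.fluct_sub (Z.comp_flow_mem t hul) hul,
        Z.koopman_fluct t hul]
    rw [← hfa, FluctuationStructure.norm_fluct_sq hal, inv_mul_intervalIntegral_eq]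
    have hFa := (stub_pencilDerivation_foelner _ D Z a hal).1
    have hineq : ∀ n : ℕ, (n : ℝ)⁻¹ * Var[∑ i ∈ Finset.range n, a ∘ chainShift (i : ℤ); Z.μ] ≤
        |t|⁻¹ * ∫ s in Set.uIoc 0 t, F n s := by
      intro n
      have h1 : Var[∑ i ∈ Finset.range n, a ∘ chainShift (i : ℤ); Z.μ] ≤
          ∫ σ, ((∑ i ∈ Finset.range n, a ∘ chainShift (i : ℤ)) σ) ^ 2 ∂Z.μ :=
        variance_le_expectation_sq (Z.memLp_of_mem (birkhoffSum_mem Z hal n)).aestronglyMeasurable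
      have h2 := integral_sq_birkhoffSum_slope_le Z hcar hoff hloc hu ht n
      calc (n : ℝ)⁻¹ * Var[∑ i ∈ Finset.range n, a ∘ chainShift (i : ℤ); Z.μ]
          ≤ (n : ℝ)⁻¹ * ∫ σ, ((∑ i ∈ Finset.range n, a ∘ chainShift (i : ℤ)) σ) ^ 2 ∂Z.μ :=
            mul_le_mul_of_nonneg_left h1 (inv_nonneg.2 (Nat.cast_nonneg n))
        _ ≤ (n : ℝ)⁻¹ * (|t|⁻¹ * ∫ s in Set.uIoc 0 t,
              ∫ σ, ((∑ i ∈ Finset.range n, (b ∘ D.flow s - b) ∘ chainShift (i : ℤ)) σ) ^ 2 ∂Z.μ) :=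
            mul_le_mul_of_nonneg_left h2 (inv_nonneg.2 (Nat.cast_nonneg n))
        _ = |t|⁻¹ * ∫ s in Set.uIoc 0 t, F n s := by
            rw [hF]
            simp only [integral_const_mul]
            ring
    have hfin : volume (Set.uIoc 0 t) < ∞ := by rw [Real.volume_uIoc]; exact ENNReal.ofReal_lt_top
    haveI : IsFiniteMeasure (volume.restrict (Set.uIoc 0 t)) :=
      ⟨by rw [Measure.restrict_apply_univ]; exact hfin⟩
    have hR : Tendsto (fun n : ℕ => |t|⁻¹ * ∫ s in Set.uIoc 0 t, F n s) atTop
        (𝓝 (|t|⁻¹ * ∫ s in Set.uIoc 0 t, ‖Z.koopman s (Z.fluct b) - Z.fluct b‖ ^ 2)) := by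
      refine (tendsto_integral_of_dominated_convergence (fun _ => 4 * K) (fun n => (hFm n).aestronglyMeasurable)
        (integrable_const _) (fun n => Eventually.of_forall fun s => hFb n s)
        (Eventually.of_forall fun s => hFlim s)).const_mul _
    exact le_of_tendsto_of_tendsto' hFa hR hineq
  -- `t⁻¹ ∫₀ᵗ ‖U_s[b] - [b]‖² ds → 0`
  have hav : Tendsto (fun t : ℝ => t⁻¹ * ∫ s in (0 : ℝ)..t, ‖Z.koopman s (Z.fluct b) - Z.fluct b‖ ^ 2)
      (𝓝[≠] 0) (𝓝 0) := by
    have h := intervalIntegral.integral_hasDerivAt_right (hφc.intervalIntegrable 0 0)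
      (hφc.stronglyMeasurableAtFilter volume (𝓝 0)) hφc.continuousAt
    have h0 : ‖Z.koopman 0 (Z.fluct b) - Z.fluct b‖ ^ 2 = 0 := by rw [hzero, sub_self, norm_zero]; ring
    rw [h0, hasDerivAt_iff_tendsto_slope_zero] at h
    refine h.congr fun t => ?_
    rw [zero_add, intervalIntegral.integral_same, sub_zero, smul_eq_mul]
  have hsq : Tendsto (fun t : ℝ => ‖t⁻¹ • (Z.koopman t (Z.fluct u) - Z.fluct u) - Z.fluct b‖ ^ 2)
      (𝓝[≠] 0) (𝓝 0) :=
    tendsto_of_tendsto_of_tendsto_of_le_of_le' tendsto_const_nhds hav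
      (Eventually.of_forall fun t => sq_nonneg _) (eventually_nhdsWithin_of_forall fun t ht => hmain t ht)
  have hnorm : Tendsto (fun t : ℝ => ‖t⁻¹ • (Z.koopman t (Z.fluct u) - Z.fluct u) - Z.fluct b‖)
      (𝓝[≠] 0) (𝓝 0) := by
    have h := hsq.sqrt
    simpa [Real.sqrt_sq (norm_nonneg _)] using h
  rw [hasDerivAt_iff_tendsto_slope_zero, tendsto_iff_norm_sub_tendsto_zero]
  refine hnorm.congr fun t => ?_
  rw [zero_add, hzero]

end Summit.AtomisticToContinuum.FouriersLaw.Theorems.DrudeDissolution.GramPencilHarmonicChaos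

end
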